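import Mathlib
import Summits.AnomalousDissipation.AnomalousDissipation.Theorems.LimitingAbsorptionScalarSectorLiftTrunc
import HarnessLib

/-!
# Route LimitingAbsorption — support item `ScalarSectorLift` (stmt-AnomalousDissipation-2941), part D:
# the flux of the truncated balance at a.e. time; a.e.-in-time modifications of weak sourced scalars

Continuation of part C (`…ScalarSectorLiftTrunc`). For a global weak solution `θ ∈ L^∞_t L²_x` of
`∂ₜθ + u·∇θ = κΔθ + h` with continuous modes `c` and truncations `P_N(t) = reTrigPoly (freqBall N) (c t)`:

* `ssl_abs_integral_sub_mul_inner_gradient_le` — the Young bound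
  `|∫ (θ' - P)⟪u', ∇P⟫| ≤ (η/2)∫‖∇P‖² + (M²/2η)∫(θ' - P)²` for a drift bounded by `M`;
* `ssl_trunc_flux_ae_eq` — at a.e. `τ ∈ (0,T)` the modal flux `∑_{|k|≤N} 2 Re (conj c · B)` equals
  `-2κ D_N + 2∫ h P_N + 2∫ (θ - P_N)⟪u, ∇P_N⟫` (Parseval pairings of part C and
  `∫ P_N ⟪u, ∇P_N⟫ = 0` by weak incompressibility, tree `integral_mul_inner_gradient_eq_zero`),
  together with the Young bound and the Parseval tail `∫(θ - P_N)² = ∫θ² - E_N ≥ 0`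
  (Robinson–Rodrigo–Sadowski 2016, Lemma 4.1; Bonicatto–Ciampa–Crippa 2023, proof of Thm. 3.3);
* `ssl_isWeakScalarTransportForcedOn_congr_ae` — the class `Torus.IsWeakScalarTransportForcedOn` only
  sees a.e.-in-time classes (all its conjuncts are time integrals or a.e. statements), so the
  representative of part B is again a weak solution (`ssl_repr_isWeakScalarTransportForcedOn`).
-/

set_option linter.dupNamespace false

noncomputable section

open scoped BigOperators Topology ENNReal NNReal InnerProductSpace ComplexConjugate
open Filter Set Function MeasureTheory UnitAddTorus Complex

namespace Summit.AnomalousDissipation.AnomalousDissipation.Theorems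

open Literature.Analysis Literature.Analysis.FunctionSpaces Literature.Analysis.FunctionSpaces.Torus
open Literature.Analysis.FluidPDE Literature.Analysis.FluidPDE.Torus
open ScalarAnomalySteadySourceFormal.Negative

variable {d : Type*} [Fintype d]

variable {κ : ℝ} {u : ℝ → UnitAddTorus d → EuclideanSpace ℝ d} {hs θ₀ : UnitAddTorus d → ℝ}
  {θ Θ : ℝ → UnitAddTorus d → ℝ} {B c : ℝ → (d → ℤ) → ℂ}

/-! ### The flux at a.e. time: physical-space form and the error bound -/

/-- **Young bound for the truncation-removal error**: for an `L²` scalar `θ'`, a smooth `P`, a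
measurable drift `u'` bounded by `M` and every `η > 0`,
`|∫ (θ' - P) ⟪u', ∇P⟫| ≤ (η/2) ∫ ‖∇P‖² + (M²/2η) ∫ (θ' - P)²`. [folklore] -/
theorem ssl_abs_integral_sub_mul_inner_gradient_le {θ' P : UnitAddTorus d → ℝ}
    {u' : UnitAddTorus d → EuclideanSpace ℝ d} (hθ' : MemLp θ' 2 volume) (hP : IsSmooth P)
    (hu' : AEStronglyMeasurable u' volume) {M : ℝ} (hM0 : 0 ≤ M) (hM : ∀ᵐ x ∂volume, ‖u' x‖ ≤ M)
    {η : ℝ} (hη : 0 < η) :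
    Integrable (fun x => (θ' x - P x) * ⟪u' x, Torus.gradient P x⟫_ℝ) volume ∧
      |∫ x, (θ' x - P x) * ⟪u' x, Torus.gradient P x⟫_ℝ| ≤
        η / 2 * (∫ x, ‖Torus.gradient P x‖ ^ 2) + M ^ 2 / (2 * η) * ∫ x, (θ' x - P x) ^ 2 := by
  have hsub : MemLp (fun x => θ' x - P x) 2 volume := hθ'.sub (hP.memLp 2)
  obtain ⟨G, hG⟩ := isCompact_univ.exists_bound_of_continuousOn hP.gradient.continuous.continuousOn
  have hgm : AEStronglyMeasurable (fun x => ⟪u' x, Torus.gradient P x⟫_ℝ) volume :=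
    hu'.inner hP.gradient.continuous.aestronglyMeasurable
  have hgb : ∀ᵐ x ∂volume, ‖⟪u' x, Torus.gradient P x⟫_ℝ‖ ≤ M * G := by
    filter_upwards [hM] with x hx
    calc ‖⟪u' x, Torus.gradient P x⟫_ℝ‖ ≤ ‖u' x‖ * ‖Torus.gradient P x‖ := norm_inner_le_norm _ _
      _ ≤ M * G := mul_le_mul hx (hG x (mem_univ x)) (norm_nonneg _) hM0
  have hint : Integrable (fun x => (θ' x - P x) * ⟪u' x, Torus.gradient P x⟫_ℝ) volume := by
    have h1 : Integrable (fun x => ⟪u' x, Torus.gradient P x⟫_ℝ * (θ' x - P x)) volume :=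
      (hsub.integrable one_le_two).bdd_mul hgm hgb
    exact h1.congr (ae_of_all _ fun x => mul_comm _ _)
  refine ⟨hint, ?_⟩
  have h2 : Integrable (fun x => (θ' x - P x) ^ 2) volume := by
    have := hsub.integrable_norm_pow two_ne_zero
    simpa only [Real.norm_eq_abs, sq_abs] using this
  have h3 : Integrable (fun x => ‖Torus.gradient P x‖ ^ 2) volume :=
    (hP.gradient.continuous.norm.pow 2).integrable_unitAddTorus
  calc |∫ x, (θ' x - P x) * ⟪u' x, Torus.gradient P x⟫_ℝ|
      ≤ ∫ x, |(θ' x - P x) * ⟪u' x, Torus.gradient P x⟫_ℝ| := abs_integral_le_integral_abs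
    _ ≤ ∫ x, (η / 2 * ‖Torus.gradient P x‖ ^ 2 + M ^ 2 / (2 * η) * (θ' x - P x) ^ 2) := by
        refine integral_mono_ae hint.abs ((h3.const_mul _).add (h2.const_mul _)) ?_
        filter_upwards [hM] with x hx
        rw [abs_mul]
        have hy := ssl_mul_le_young (x := ‖Torus.gradient P x‖) (y := M * |θ' x - P x|) hη
        calc |θ' x - P x| * |⟪u' x, Torus.gradient P x⟫_ℝ|
            ≤ |θ' x - P x| * (M * ‖Torus.gradient P x‖) := by
              refine mul_le_mul_of_nonneg_left ?_ (abs_nonneg _)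
              calc |⟪u' x, Torus.gradient P x⟫_ℝ| ≤ ‖u' x‖ * ‖Torus.gradient P x‖ := abs_real_inner_le_norm _ _
                _ ≤ M * ‖Torus.gradient P x‖ := mul_le_mul_of_nonneg_right hx (norm_nonneg _)
          _ = ‖Torus.gradient P x‖ * (M * |θ' x - P x|) := by ring
          _ ≤ (η * ‖Torus.gradient P x‖ ^ 2 + (M * |θ' x - P x|) ^ 2 / η) / 2 := hy
          _ = η / 2 * ‖Torus.gradient P x‖ ^ 2 + M ^ 2 / (2 * η) * (θ' x - P x) ^ 2 := by
              rw [mul_pow, sq_abs]; ring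
    _ = η / 2 * (∫ x, ‖Torus.gradient P x‖ ^ 2) + M ^ 2 / (2 * η) * ∫ x, (θ' x - P x) ^ 2 := by
        rw [integral_add (h3.const_mul _) (h2.const_mul _), integral_const_mul, integral_const_mul]

/-- **The flux of the truncated balance at a.e. time, in physical space.** For a.e. `τ ∈ (0,T)`,
with `P_N = reTrigPoly (freqBall N) (c τ)` (the truncation of `θ(τ)`), `E_N = ∑_{|k|≤N} ‖c(τ,k)‖²`
and `D_N = 4π² ∑_{|k|≤N} |k|² ‖c(τ,k)‖²`:
`∑_{|k|≤N} 2 Re (conj c(τ,k) B(τ,k)) = -2κ D_N + 2∫ h P_N + 2∫ (θ(τ) - P_N)⟪u(τ), ∇P_N⟫`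
(the three modal sums in physical space, and `∫ P_N ⟪u, ∇P_N⟫ = 0` by weak incompressibility);
moreover the last integral obeys the Young bound with the Parseval tail `∫ (θ - P_N)² = ∫θ² - E_N ≥ 0`,
for a drift bounded by `M` on `(0,T) × T^d`. [folklore] -/
theorem ssl_trunc_flux_ae_eq [DecidableEq d]
    (hB : B = fun s k => -(((4 * Real.pi ^ 2 * κ * freqNormSq k : ℝ)) : ℂ) *
        mFourierCoeff (fun x => (θ s x : ℂ)) k -
      ∑ j, (2 * Real.pi * I * (k j)) * mFourierCoeff (fun x => ((θ s x * u s x j : ℝ) : ℂ)) k +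
        mFourierCoeff (fun x => (hs x : ℂ)) k)
    (hc : c = fun t k => mFourierCoeff (fun x => (θ₀ x : ℂ)) k + ∫ s in Ioc 0 t, B s k)
    {T : ℝ} (hsolT : IsWeakScalarTransportForcedOn T κ u (fun _ => hs) θ₀ θ)
    (hhs : MemLp hs 2 volume) (hθ₀ : Integrable θ₀ volume) {M : ℝ} (hM0 : 0 ≤ M)
    (hM : ∀ᵐ τ ∂(volume.restrict (Ioo 0 T)), ∀ᵐ x ∂volume, ‖u τ x‖ ≤ M) (N : ℕ) :
    ∀ᵐ τ ∂(volume.restrict (Ioo 0 T)),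
      (∑ k ∈ freqBall N, 2 * (conj (c τ k) * B τ k).re =
        -(2 * κ) * (4 * Real.pi ^ 2 * ∑ k ∈ freqBall N, freqNormSq k * ‖c τ k‖ ^ 2) +
          2 * (∫ x, hs x * reTrigPoly (freqBall N) (c τ) x) +
          2 * ∫ x, (θ τ x - reTrigPoly (freqBall N) (c τ) x) *
            ⟪u τ x, Torus.gradient (reTrigPoly (freqBall N) (c τ)) x⟫_ℝ) ∧
      (∀ η, 0 < η → |∫ x, (θ τ x - reTrigPoly (freqBall N) (c τ) x) *
            ⟪u τ x, Torus.gradient (reTrigPoly (freqBall N) (c τ)) x⟫_ℝ| ≤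
          η / 2 * (4 * Real.pi ^ 2 * ∑ k ∈ freqBall N, freqNormSq k * ‖c τ k‖ ^ 2) +
            M ^ 2 / (2 * η) * ((∫ x, θ τ x ^ 2) - ∑ k ∈ freqBall N, ‖c τ k‖ ^ 2)) ∧
      0 ≤ (∫ x, θ τ x ^ 2) - ∑ k ∈ freqBall N, ‖c τ k‖ ^ 2 := by
  have hum : ∀ᵐ τ ∂(volume.restrict (Ioo 0 T)), AEStronglyMeasurable (u τ) volume :=
    hsolT.aestronglyMeasurable_uncurry_velocity.prodMk_left
  filter_upwards [ssl_ae_mode_eq hB hc hsolT (hhs.integrable one_le_two) hθ₀, hsolT.ae_isWeaklyDivFree,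
    hum, hM] with τ hτ hdiv huτ hMτ
  obtain ⟨hθ2, hcoef⟩ := hτ
  set S := freqBall (d := d) N with hS
  set P := reTrigPoly S (c τ) with hP_def
  have hPs : IsSmooth P := isSmooth_reTrigPoly _ _
  have hsymm : IsConjSymmScalar (c τ) := ssl_isConjSymmScalar_mode hB hc τ
  -- the truncation of `θ(τ)` is `P`
  have hcfun : (fun k => mFourierCoeff (fun x => (θ τ x : ℂ)) k) = c τ := funext hcoef
  have hPtr : scalarTruncate N (θ τ) = P := by
    rw [scalarTruncate, hcfun]
  -- the Parseval tail and the dissipation of `P`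
  have htail : ∫ x, (θ τ x - P x) ^ 2 = (∫ x, θ τ x ^ 2) - ∑ k ∈ S, ‖c τ k‖ ^ 2 := by
    rw [← hPtr, integral_sq_sub_scalarTruncate hθ2 N]
    simp only [hcoef, hS]
  have hgrad : ∫ x, ‖Torus.gradient P x‖ ^ 2 = 4 * Real.pi ^ 2 * ∑ k ∈ S, freqNormSq k * ‖c τ k‖ ^ 2 :=
    integral_norm_sq_gradient_reTrigPoly neg_mem_freqBall_of_mem hsymm
  refine ⟨?_, fun η hη => ?_, ?_⟩
  · -- the identity
    have hdamp := ssl_sum_re_conj_mul_damping S (c τ) κ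
    have hsrc := ssl_sum_re_conj_mul_source N hsymm hhs
    have htr := ssl_sum_re_conj_mul_transport N hsymm hθ2 huτ hMτ
    -- `∫ θ ⟪u, ∇P⟫ = ∫ (θ - P) ⟪u, ∇P⟫` (weak incompressibility)
    have hzero : ∫ x, P x * ⟪u τ x, Torus.gradient P x⟫_ℝ = 0 :=
      integral_mul_inner_gradient_eq_zero hPs hdiv
    obtain ⟨hint1, -⟩ := ssl_abs_integral_sub_mul_inner_gradient_le hθ2 hPs huτ hM0 hMτ one_pos
    obtain ⟨hint0, -⟩ := ssl_abs_integral_sub_mul_inner_gradient_le (MemLp.zero' (p := 2) (μ := volume)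
      (ε := ℝ)) hPs huτ hM0 hMτ one_pos
    have hint2 : Integrable (fun x => P x * ⟪u τ x, Torus.gradient P x⟫_ℝ) volume := by
      have := hint0.neg
      refine this.congr (ae_of_all _ fun x => ?_)
      simp only [zero_sub, neg_mul, Pi.neg_apply, neg_neg]
    have hsplit : ∫ x, θ τ x * ⟪u τ x, Torus.gradient P x⟫_ℝ =
        ∫ x, (θ τ x - P x) * ⟪u τ x, Torus.gradient P x⟫_ℝ := by
      have e : (fun x => θ τ x * ⟪u τ x, Torus.gradient P x⟫_ℝ) =
          fun x => (θ τ x - P x) * ⟪u τ x, Torus.gradient P x⟫_ℝ + P x * ⟪u τ x, Torus.gradient P x⟫_ℝ := by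
        funext x; ring
      rw [e, integral_add hint1 hint2, hzero, add_zero]
    -- expand `B` and split the modal sum
    have hexp : ∀ k, 2 * (conj (c τ k) * B τ k).re =
        2 * (conj (c τ k) * (-(((4 * Real.pi ^ 2 * κ * freqNormSq k : ℝ)) : ℂ) * c τ k)).re +
        2 * (conj (c τ k) * -(∑ j, (2 * Real.pi * I * (k j)) *
          mFourierCoeff (fun x => ((θ τ x * u τ x j : ℝ) : ℂ)) k)).re +
        2 * (conj (c τ k) * mFourierCoeff (fun x => (hs x : ℂ)) k).re := by
      intro k
      have hBk : B τ k = -(((4 * Real.pi ^ 2 * κ * freqNormSq k : ℝ)) : ℂ) * c τ k -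
          ∑ j, (2 * Real.pi * I * (k j)) * mFourierCoeff (fun x => ((θ τ x * u τ x j : ℝ) : ℂ)) k +
            mFourierCoeff (fun x => (hs x : ℂ)) k := by
        simp only [hB, hcoef]
      rw [hBk]
      simp only [mul_sub, mul_add, mul_neg, Complex.add_re, Complex.sub_re, Complex.neg_re]
      ring
    rw [Finset.sum_congr rfl fun k _ => hexp k, Finset.sum_add_distrib, Finset.sum_add_distrib,
      ← Finset.mul_sum, ← Finset.mul_sum, ← Finset.mul_sum, hdamp, hsrc, htr, hsplit]
    ring
  · -- the Young bound
    obtain ⟨-, hbd⟩ := ssl_abs_integral_sub_mul_inner_gradient_le hθ2 hPs huτ hM0 hMτ hη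
    rw [hgrad, htail] at hbd
    exact hbd
  · rw [← htail]
    exact integral_nonneg fun x => sq_nonneg _

/-! ### The weak sourced class only sees a.e.-in-time classes -/

omit [Fintype d] in
/-- A time-null set times the torus is null for the restricted space–time volume on
`ℝ × ℝ^d` (through which the space–time lifts are measured). [folklore] -/
theorem ssl_stLift_ae_eq_of_ae_eq [Fintype d] {T : ℝ} {θ θ' : ℝ → UnitAddTorus d → ℝ}
    (hae : ∀ᵐ t ∂(volume.restrict (Ioo 0 T)), θ' t = θ t) :
    stLift θ' =ᵐ[volume.restrict (Ioo 0 T ×ˢ (univ : Set (EuclideanSpace ℝ d)))] stLift θ := by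
  have hN : volume ({t | ¬ θ' t = θ t} ∩ Ioo 0 T) = 0 := by
    have h := hae
    rw [ae_iff, Measure.restrict_apply' measurableSet_Ioo] at h
    exact h
  rw [Filter.EventuallyEq, ae_restrict_iff' (measurableSet_Ioo.prod MeasurableSet.univ), ae_iff]
  refine measure_mono_null (t := ({t | ¬ θ' t = θ t} ∩ Ioo 0 T) ×ˢ (univ : Set (EuclideanSpace ℝ d)))
    ?_ ?_
  · intro p hp
    simp only [mem_setOf_eq, Classical.not_imp, mem_prod, mem_univ, and_true] at hp
    refine ⟨⟨?_, hp.1⟩, mem_univ _⟩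
    intro h
    exact hp.2 (by simp only [stLift, h])
  · rw [show (volume : Measure (ℝ × EuclideanSpace ℝ d)) = (volume : Measure ℝ).prod volume from rfl,
      Measure.prod_prod, hN, zero_mul]

/-- **The weak sourced class only sees a.e.-in-time classes**: modifying a weak solution of
`∂ₜθ + u·∇θ = κΔθ + s` on a null set of times gives a weak solution with the same data (all
conjuncts of `Torus.IsWeakScalarTransportForcedOn` are integrals in time or a.e.-in-time
statements). [folklore] -/
theorem ssl_isWeakScalarTransportForcedOn_congr_ae {T κ : ℝ} {u : ℝ → UnitAddTorus d → EuclideanSpace ℝ d}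
    {s : ℝ → UnitAddTorus d → ℝ} {θ₀ : UnitAddTorus d → ℝ} {θ θ' : ℝ → UnitAddTorus d → ℝ}
    (h : IsWeakScalarTransportForcedOn T κ u s θ₀ θ)
    (hae : ∀ᵐ t ∂(volume.restrict (Ioo 0 T)), θ' t = θ t) :
    IsWeakScalarTransportForcedOn T κ u s θ₀ θ' where
  aestronglyMeasurable := h.aestronglyMeasurable.congr (ssl_stLift_ae_eq_of_ae_eq hae).symm
  aestronglyMeasurable_velocity := h.aestronglyMeasurable_velocity
  aestronglyMeasurable_source := h.aestronglyMeasurable_source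
  ae_lintegral_sq_le := by
    obtain ⟨C, hC⟩ := h.ae_lintegral_sq_le
    refine ⟨C, ?_⟩
    filter_upwards [hC, hae] with t ht hte
    rw [hte]
    exact ht
  lintegral_velocity_lt_top := h.lintegral_velocity_lt_top
  lintegral_mul_lt_top := by
    have e : ∫⁻ t in Ioo 0 T, ∫⁻ x, ‖u t x‖ₑ * ‖θ' t x‖ₑ = ∫⁻ t in Ioo 0 T, ∫⁻ x, ‖u t x‖ₑ * ‖θ t x‖ₑ := by
      refine lintegral_congr_ae ?_
      filter_upwards [hae] with t ht
      rw [ht]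
    rw [e]
    exact h.lintegral_mul_lt_top
  lintegral_source_lt_top := h.lintegral_source_lt_top
  ae_isWeaklyDivFree := h.ae_isWeaklyDivFree
  weak_eq ψ hψ := by
    have e : ∫ t in Ioo 0 T, ∫ x, θ' t x *
        (FunctionSpaces.Torus.timeDeriv ψ t x + ⟪u t x, FunctionSpaces.Torus.gradient (ψ t) x⟫_ℝ +
          κ * FunctionSpaces.Torus.laplacian (ψ t) x) =
        ∫ t in Ioo 0 T, ∫ x, θ t x *
        (FunctionSpaces.Torus.timeDeriv ψ t x + ⟪u t x, FunctionSpaces.Torus.gradient (ψ t) x⟫_ℝ +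
          κ * FunctionSpaces.Torus.laplacian (ψ t) x) := by
      refine integral_congr_ae ?_
      filter_upwards [hae] with t ht
      rw [ht]
    rw [e]
    exact h.weak_eq ψ hψ

/-- **The representative is a weak solution** with datum `θ₀` on every horizon (it agrees with
`θ` at a.e. time). [folklore] -/
theorem ssl_repr_isWeakScalarTransportForcedOn {T : ℝ}
    (hsolT : IsWeakScalarTransportForcedOn T κ u (fun _ => hs) θ₀ θ)
    (hae : ∀ᵐ t ∂(volume.restrict (Ioo 0 T)), Θ t = θ t) :
    IsWeakScalarTransportForcedOn T κ u (fun _ => hs) θ₀ Θ :=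
  ssl_isWeakScalarTransportForcedOn_congr_ae hsolT hae

end Summit.AnomalousDissipation.AnomalousDissipation.Theorems

end
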